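import Summits.CriticalPhenomena.PercolationContinuityZ3.Theorems.PercNearOneGluingAdditiveGluingFingerDomination
import HarnessLib

/-! # Crux `PercNearOneGluing.AdditiveGluing` (stmt-CriticalPhenomena-4576) — the finger multi-edge Lemma 3 (`stub_fingerML3_vp`):
# TRANSFER of the star inequality from any certified vertex (seat (b) V⁺-form, depth prover `png-dp-vplus`, gen 6)

Support file (`--supports stmt-CriticalPhenomena-4576`); no definitions, no named facts, no sorries.  Companions:
`…AdditiveGluingFingerDomination.lean` (`fingerML3_setForm_iff_starForm`, `fingerML3_of_starForm`, `fingerML3_of_domination`),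
`…AdditiveGluingFingerSetForm.lean` (`fingerML3_iff_setForm`).

Setting of the stub: weighting `K` on `Fin n`, relays `A ∋ b`, finger block `N` (`Disjoint N A`, positive pairs at `N` go to `A ∪ N`),
`R` = some pair `N–A` open, `U = ⋃_{v∈N}{v↔b}`, and for a vertex `x` the GLUING GAIN event `U ∩ {x↔N} ∩ {x↮b}` (the block reaches `b`,
`x` is attached to the block, `x ↮ b`).  Write `ρs(x) := μ_K(R ∩ {x↔b}) + μ_K(U ∩ {x↔N} ∩ {x↮b})` ( = `μ_{K/N}(R ∩ {x↔b})`, the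
`R`-restricted two-point function of `x` in the GLUED weighting).  The conclusion of the stub at the designation `x` is, in star form,
`ρs(x) ≤ μ_K(U)` (`fingerML3_setForm_iff_starForm`).  Hence it TRANSFERS along the order `ρs`:

* `fingerML3_of_splitTransfer` — if the star inequality holds at some vertex `y` (`ρs(y) ≤ μ_K(U)`) and `ρs(d) ≤ ρs(y)`, the stub's
  conclusion holds at `d`.
* `fingerML3_starForm_of_glued` — for a relay `y ∈ A`, the glued form of the conclusion at `y` gives the star inequality at `y`
  (so any landed instance of the stub — `fingerML3_of_card_le_four` at the unglued-weakest contact, Lemma 5 at the base-weakest contact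
  (`block_multiEdge_singleWitness`), `fingerML3_twoContacts…` — is a source for the transfer).
* `fingerML3_transfer_relay` — the two combined: conclusion at a relay `y` + `ρs(d) ≤ ρs(y)` ⇒ conclusion at `d`.
These are the "M0 / MK / B" terminal certificates of the peeling analysis in memo MEMO-gen6 §5 (run/shared/lean/prim/prim-png-dp-vplus/):
after peeling finger pairs with `block_multiEdge_peel`, the remaining system is certified at its base-weakest or unglued-weakest contact and
transferred to `d` by the comparison `ρs(d) ≤ ρs(y)`.
[cite: KozmaNitzan2024, eq. (3) p. 3, Thm 4 and Lemma 5 (§3.2, pp. 12–14), §3.1 (gluing)]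
-/

namespace Summit.CriticalPhenomena.PercolationContinuityZ3.Theorems

open MeasureTheory Set
open Literature.Probability.LatticeModels (prodBernoulli)
open Literature.Probability.Percolation (BondConfig openConn openGraph)

noncomputable section
open Classical

section FingerSplitTransfer

open Literature.Probability.LatticeModels Literature.Probability.Percolation

variable {n : ℕ}

/-- **Transfer of the star inequality along `ρs`.**  If `ρs(y) ≤ μ_K(U)` for some vertex `y` and `ρs(d) ≤ ρs(y)`, where
`ρs(x) = μ_K(R ∩ {x↔b}) + μ_K(U ∩ {x↔N} ∩ {x↮b})`, then the conclusion of `stub_fingerML3_vp` holds at `d`.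
[cite: KozmaNitzan2024, eq. (3) p. 3, Thm 4 (pp. 12–14)] -/
theorem fingerML3_of_splitTransfer (K : Sym2 (Fin n) → unitInterval) (A N : Finset (Fin n)) (d b y : Fin n)
    (hb : b ∈ A) (hd : d ∈ A) (hNA : Disjoint N A)
    (hfree : ∀ v ∈ N, ∀ y' : Fin n, y' ∉ A → y' ∉ N → (K s(v, y') : ℝ) = 0)
    (hy : (prodBernoulli K).real ({ω : Set (Sym2 (Fin n)) | ∃ v ∈ N, ∃ a ∈ A, s(v, a) ∈ ω} ∩ openConn y b) +
      (prodBernoulli K).real ((⋃ v ∈ N, openConn v b) ∩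
          {ω : BondConfig (Fin n) | ∀ x ∈ (↑N : Set (Fin n)), ¬ (openGraph ω).Reachable y x}ᶜ ∩ (openConn y b)ᶜ) ≤
      (prodBernoulli K).real (⋃ v ∈ N, openConn v b))
    (htr : (prodBernoulli K).real ({ω : Set (Sym2 (Fin n)) | ∃ v ∈ N, ∃ a ∈ A, s(v, a) ∈ ω} ∩ openConn d b) +
      (prodBernoulli K).real ((⋃ v ∈ N, openConn v b) ∩
          {ω : BondConfig (Fin n) | ∀ x ∈ (↑N : Set (Fin n)), ¬ (openGraph ω).Reachable d x}ᶜ ∩ (openConn d b)ᶜ) ≤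
      (prodBernoulli K).real ({ω : Set (Sym2 (Fin n)) | ∃ v ∈ N, ∃ a ∈ A, s(v, a) ∈ ω} ∩ openConn y b) +
      (prodBernoulli K).real ((⋃ v ∈ N, openConn v b) ∩
          {ω : BondConfig (Fin n) | ∀ x ∈ (↑N : Set (Fin n)), ¬ (openGraph ω).Reachable y x}ᶜ ∩ (openConn y b)ᶜ)) :
    (prodBernoulli (fun e' : Sym2 (Fin n) => if (∀ y ∈ e', y ∈ N) ∧ ¬ e'.IsDiag then 1 else K e')).real
        ({ω : Set (Sym2 (Fin n)) | ∃ v ∈ N, ∃ a ∈ A, s(v, a) ∈ ω} ∩ openConn d b) ≤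
      (prodBernoulli (fun e' : Sym2 (Fin n) => if (∀ y ∈ e', y ∈ N) ∧ ¬ e'.IsDiag then 1 else K e')).real
        ({ω : Set (Sym2 (Fin n)) | ∃ v ∈ N, ∃ a ∈ A, s(v, a) ∈ ω} ∩ ⋃ v ∈ N, openConn v b) :=
  fingerML3_of_starForm K A N d b hb hd hNA hfree (le_trans htr hy)

/-- **The glued conclusion at a relay gives the star inequality there.**  For `y ∈ A`, the glued form
`μ_{K/N}(R ∩ {y↔b}) ≤ μ_{K/N}(R ∩ U)` is equivalent to `ρs(y) ≤ μ_K(U)` (`fingerML3_iff_setForm` + `fingerML3_setForm_iff_starForm`);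
this is the forward direction. [cite: KozmaNitzan2024, eq. (3) p. 3, §3.1 (gluing)] -/
theorem fingerML3_starForm_of_glued (K : Sym2 (Fin n) → unitInterval) (A N : Finset (Fin n)) (y b : Fin n)
    (hb : b ∈ A) (hy : y ∈ A) (hNA : Disjoint N A)
    (hfree : ∀ v ∈ N, ∀ y' : Fin n, y' ∉ A → y' ∉ N → (K s(v, y') : ℝ) = 0)
    (hglued : (prodBernoulli (fun e' : Sym2 (Fin n) => if (∀ y ∈ e', y ∈ N) ∧ ¬ e'.IsDiag then 1 else K e')).real
        ({ω : Set (Sym2 (Fin n)) | ∃ v ∈ N, ∃ a ∈ A, s(v, a) ∈ ω} ∩ openConn y b) ≤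
      (prodBernoulli (fun e' : Sym2 (Fin n) => if (∀ y ∈ e', y ∈ N) ∧ ¬ e'.IsDiag then 1 else K e')).real
        ({ω : Set (Sym2 (Fin n)) | ∃ v ∈ N, ∃ a ∈ A, s(v, a) ∈ ω} ∩ ⋃ v ∈ N, openConn v b)) :
    (prodBernoulli K).real ({ω : Set (Sym2 (Fin n)) | ∃ v ∈ N, ∃ a ∈ A, s(v, a) ∈ ω} ∩ openConn y b) +
      (prodBernoulli K).real ((⋃ v ∈ N, openConn v b) ∩
          {ω : BondConfig (Fin n) | ∀ x ∈ (↑N : Set (Fin n)), ¬ (openGraph ω).Reachable y x}ᶜ ∩ (openConn y b)ᶜ) ≤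
      (prodBernoulli K).real (⋃ v ∈ N, openConn v b) :=
  (fingerML3_setForm_iff_starForm K A N y b hb hy hNA hfree).1 ((fingerML3_iff_setForm K A N y b hNA).1 hglued)

/-- **Relay-to-designation transfer.**  If the conclusion of `stub_fingerML3_vp` holds (glued form) at a relay `y ∈ A` — e.g. at the
base-weakest contact by Kozma–Nitzan's Lemma 5, or at the unglued-weakest contact of a block touching at most three relays besides `b`
(`fingerML3_of_card_le_four`) — and `ρs(d) ≤ ρs(y)`, then it holds at `d`. [cite: KozmaNitzan2024, Thm 4 and Lemma 5 (pp. 12–14)] -/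
theorem fingerML3_transfer_relay (K : Sym2 (Fin n) → unitInterval) (A N : Finset (Fin n)) (d b y : Fin n)
    (hb : b ∈ A) (hd : d ∈ A) (hy : y ∈ A) (hNA : Disjoint N A)
    (hfree : ∀ v ∈ N, ∀ y' : Fin n, y' ∉ A → y' ∉ N → (K s(v, y') : ℝ) = 0)
    (hglued : (prodBernoulli (fun e' : Sym2 (Fin n) => if (∀ y ∈ e', y ∈ N) ∧ ¬ e'.IsDiag then 1 else K e')).real
        ({ω : Set (Sym2 (Fin n)) | ∃ v ∈ N, ∃ a ∈ A, s(v, a) ∈ ω} ∩ openConn y b) ≤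
      (prodBernoulli (fun e' : Sym2 (Fin n) => if (∀ y ∈ e', y ∈ N) ∧ ¬ e'.IsDiag then 1 else K e')).real
        ({ω : Set (Sym2 (Fin n)) | ∃ v ∈ N, ∃ a ∈ A, s(v, a) ∈ ω} ∩ ⋃ v ∈ N, openConn v b))
    (htr : (prodBernoulli K).real ({ω : Set (Sym2 (Fin n)) | ∃ v ∈ N, ∃ a ∈ A, s(v, a) ∈ ω} ∩ openConn d b) +
      (prodBernoulli K).real ((⋃ v ∈ N, openConn v b) ∩
          {ω : BondConfig (Fin n) | ∀ x ∈ (↑N : Set (Fin n)), ¬ (openGraph ω).Reachable d x}ᶜ ∩ (openConn d b)ᶜ) ≤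
      (prodBernoulli K).real ({ω : Set (Sym2 (Fin n)) | ∃ v ∈ N, ∃ a ∈ A, s(v, a) ∈ ω} ∩ openConn y b) +
      (prodBernoulli K).real ((⋃ v ∈ N, openConn v b) ∩
          {ω : BondConfig (Fin n) | ∀ x ∈ (↑N : Set (Fin n)), ¬ (openGraph ω).Reachable y x}ᶜ ∩ (openConn y b)ᶜ)) :
    (prodBernoulli (fun e' : Sym2 (Fin n) => if (∀ y ∈ e', y ∈ N) ∧ ¬ e'.IsDiag then 1 else K e')).real
        ({ω : Set (Sym2 (Fin n)) | ∃ v ∈ N, ∃ a ∈ A, s(v, a) ∈ ω} ∩ openConn d b) ≤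
      (prodBernoulli (fun e' : Sym2 (Fin n) => if (∀ y ∈ e', y ∈ N) ∧ ¬ e'.IsDiag then 1 else K e')).real
        ({ω : Set (Sym2 (Fin n)) | ∃ v ∈ N, ∃ a ∈ A, s(v, a) ∈ ω} ∩ ⋃ v ∈ N, openConn v b) :=
  fingerML3_of_splitTransfer K A N d b y hb hd hNA hfree (fingerML3_starForm_of_glued K A N y b hb hy hNA hfree hglued) htr

end FingerSplitTransfer

end

end Summit.CriticalPhenomena.PercolationContinuityZ3.Theorems
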